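import Summits.RiemannHypothesis.RiemannHypothesis.Theorems.SpectralTraceWindowStepRungCorridor
import Summits.RiemannHypothesis.RiemannHypothesis.Theorems.WeilWindowFlowStrictUnderRHZeroSide
import Summits.RiemannHypothesis.RiemannHypothesis.Theorems.WeilWindowFlowStrictUnderRHJensen
import HarnessLib

/-!
# `WindowStep`, line `conjugate-point` — stub `stub_gapLemma`

Support file for the crux `stmt-RiemannHypothesis-14659`
(`Summit.RiemannHypothesis.RiemannHypothesis.Theses.SpectralTrace.WindowStep`), line
`conjugate-point`: the RH-FREE gap lemma. A real family `γ : ι → ℝ` of BOUNDED multiplicity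
(`#{i : γ_i = x} ≤ M` for every `x`) reproducing the Weil functional on the Weil tests supported in
`[-2a, 2a]` is never contained in the real zero set of the transform
`û(1/2 + i·) = weilMellin u (1/2 + ·I)` of a ground state `u` of the window `[-a, a]`
(`stub_gapLemma`, verbatim as registered).

## §1 Jensen count of the real zeros of a ground-state transform

For a ground state `u` (`IsWeilGroundState a u`) put `F(z) := û(1/2 + iz)`. Then `F` is entire
(`IsWeilGroundState.differentiable_weilMellin`), of exponential type `a` and bounded on the real
axis, `‖F z‖ ≤ max 1 ‖u‖₁ · e^{a |Im z|}` (`norm_weilMellin_half_add_le`), and `F ≢ 0` on `ℝ`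
(`exists_weilMellin_half_line_ne_zero`: `L¹` Fourier uniqueness and `‖u‖₂ = 1`). Hence, by the
Jensen count of real zeros of an entire function of exponential type
(`WeilWindowFlowStrictUnderRH.card_real_zeros_le`, Mathlib's `AnalyticOnNhd.sum_divisor_le` on the
discs of radii `r < 2r`), the real zeros of `F` have an at most LINEAR counting function: there are
`α > 0`, `β ≥ 0` with `#Z ≤ α r + β` for every finite set `Z` of real zeros of `F` in `[-r, r]`
(`exists_card_real_zeros_le`; around the base point: `exists_card_real_zeros_near_le`,
`groundState_card_real_zeros_le`). These are public, for reuse by the edge stub of the line.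

## §2 The gap lemma

Suppose every `γ_i` is a zero of `F`. The lower local Weyl law
(`card_near_ge_log_of_windowTrace` at level `2a`, landed) gives `R₀ > 0`, `c > 0`, `C` and, around
every height `T`, a finite set `s_T` of indices with `|γ_i − T| ≤ R₀` and `#s_T ≥ c log(1+|T|) − C`.
Take the `N` heights `T_j = L j`, `N ≤ j < 2N`, `L = 2R₀ + 2`: the sets `s_{T_j}` are pairwise
disjoint (their windows are), each has `≥ c log N − C` elements, so their union `U` has
`#U ≥ N (c log N − C)`; the fibres of `γ` have `≤ M` elements, so `γ(U)` is a set of at least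
`#U / M` distinct real zeros of `F`, all in `[-(R₀ + 2LN), R₀ + 2LN]`, whence by §1
`N (c log N − C) ≤ M (α (R₀ + 2LN) + β)` — false once `c log N > C + M (2Lα + αR₀ + β) + 1`.
-/

set_option linter.dupNamespace false

noncomputable section

open Complex Set Filter MeasureTheory
open scoped Real Topology

namespace Summit.RiemannHypothesis.RiemannHypothesis.Theorems.SpectralTraceWindowStep

open Literature.NumberTheory.LFunctions
open Summit.RiemannHypothesis.RiemannHypothesis.Theorems.WeilWindowFlowStrictUnderRH

/-! ## §1 Jensen count of the real zeros of a ground-state transform -/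

variable {a : ℝ} {u : ℝ → ℂ}

/-- The transform `z ↦ û(1/2 + iz)` of a ground state is entire. [folklore] -/
theorem differentiable_weilMellin_half_add (hu : IsWeilGroundState a u) :
    Differentiable ℂ (fun z : ℂ => weilMellin u (1 / 2 + z * I)) :=
  hu.differentiable_weilMellin.comp
    ((differentiable_const _).add (differentiable_id.mul (differentiable_const _)))

/-- **Jensen count around a non-vanishing point, explicit form.** If `û(1/2 + iξ) ≠ 0` (`ξ` real),
then for every `r > 0` every finite set `Z` of real zeros `x` of `û(1/2 + i·)` with `|x − ξ| ≤ r`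
has `#Z ≤ (log (max 1 ‖u‖₁) + 2 a r − log ‖û(1/2 + iξ)‖) / log 2`. [folklore] -/
theorem card_real_zeros_weilMellin_le (hu : IsWeilGroundState a u) {ξ : ℝ}
    (hξ : weilMellin u (1 / 2 + (ξ : ℂ) * I) ≠ 0) {r : ℝ} (hr : 0 < r) (Z : Finset ℝ)
    (hZ : ∀ x ∈ Z, |x - ξ| ≤ r ∧ weilMellin u (1 / 2 + (x : ℂ) * I) = 0) :
    (Z.card : ℝ) ≤ (Real.log (max 1 (∫ t, ‖u t‖)) + a * (2 * r)
      - Real.log ‖weilMellin u (1 / 2 + (ξ : ℂ) * I)‖) / Real.log 2 :=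
  card_real_zeros_le (F := fun z : ℂ => weilMellin u (1 / 2 + z * I))
    (differentiable_weilMellin_half_add hu) hξ (le_max_left _ _) hu.pos.le
    (norm_weilMellin_half_add_le hu) hr Z hZ

/-- **Linear Jensen count of the real zeros of a ground-state transform (centred at `0`).** For a
ground state `u` of the window `[-a, a]` there are `α > 0` and `β ≥ 0` such that for every `r ≥ 0`
every finite set `Z` of real zeros `x` of `û(1/2 + i·)` with `|x| ≤ r` has `#Z ≤ α r + β`.
(`û(1/2 + iξ) ≠ 0` for some real `ξ`; Jensen on the discs about `ξ` of radii
`r + |ξ| + 1 < 2(r + |ξ| + 1)`.) [folklore] -/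
theorem exists_card_real_zeros_le (hu : IsWeilGroundState a u) :
    ∃ α β : ℝ, 0 < α ∧ 0 ≤ β ∧ ∀ r : ℝ, 0 ≤ r → ∀ Z : Finset ℝ,
      (∀ x ∈ Z, |x| ≤ r ∧ weilMellin u (1 / 2 + (x : ℂ) * I) = 0) →
        (Z.card : ℝ) ≤ α * r + β := by
  obtain ⟨ξ, hξ⟩ := exists_weilMellin_half_line_ne_zero hu
  have ha : 0 < a := hu.pos
  have hlog2 : 0 < Real.log 2 := Real.log_pos one_lt_two
  set K : ℝ := Real.log (max 1 (∫ t, ‖u t‖)) - Real.log ‖weilMellin u (1 / 2 + (ξ : ℂ) * I)‖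
    with hK
  set β₀ : ℝ := (K + a * (2 * (|ξ| + 1))) / Real.log 2 with hβ₀
  have hmain : ∀ r : ℝ, 0 ≤ r → ∀ Z : Finset ℝ,
      (∀ x ∈ Z, |x| ≤ r ∧ weilMellin u (1 / 2 + (x : ℂ) * I) = 0) →
        (Z.card : ℝ) ≤ 2 * a / Real.log 2 * r + β₀ := by
    intro r hr Z hZ
    have hr' : 0 < r + |ξ| + 1 := by positivity
    have hZ' : ∀ x ∈ Z, |x - ξ| ≤ r + |ξ| + 1 ∧ weilMellin u (1 / 2 + (x : ℂ) * I) = 0 := by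
      intro x hx
      refine ⟨?_, (hZ x hx).2⟩
      have h1 : |x - ξ| ≤ |x| + |ξ| := abs_sub x ξ
      linarith [(hZ x hx).1]
    have h := card_real_zeros_weilMellin_le hu hξ hr' Z hZ'
    have heq : (Real.log (max 1 (∫ t, ‖u t‖)) + a * (2 * (r + |ξ| + 1))
        - Real.log ‖weilMellin u (1 / 2 + (ξ : ℂ) * I)‖) / Real.log 2
        = 2 * a / Real.log 2 * r + β₀ := by
      rw [hβ₀, hK]
      field_simp
      ring
    rw [heq] at h
    exact h
  have hβ₀nn : 0 ≤ β₀ := by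
    have h := hmain 0 le_rfl ∅ (by simp)
    simpa using h
  exact ⟨2 * a / Real.log 2, β₀, by positivity, hβ₀nn, hmain⟩

/-- **Linear Jensen count around the base point.** For a ground state `u` of the window `[-a, a]`
there are a real `ξ` with `û(1/2 + iξ) ≠ 0` and `α > 0`, `β ≥ 0` such that for every `r ≥ 0` every
finite set `Z` of real zeros `x` of `û(1/2 + i·)` with `|x − ξ| ≤ r` has `#Z ≤ α r + β`. [folklore] -/
theorem exists_card_real_zeros_near_le (hu : IsWeilGroundState a u) :
    ∃ ξ α β : ℝ, weilMellin u (1 / 2 + (ξ : ℂ) * I) ≠ 0 ∧ 0 < α ∧ 0 ≤ β ∧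
      ∀ r : ℝ, 0 ≤ r → ∀ Z : Finset ℝ,
        (∀ x ∈ Z, |x - ξ| ≤ r ∧ weilMellin u (1 / 2 + (x : ℂ) * I) = 0) →
          (Z.card : ℝ) ≤ α * r + β := by
  obtain ⟨ξ, hξ⟩ := exists_weilMellin_half_line_ne_zero hu
  obtain ⟨α, β, hα, hβ, h⟩ := exists_card_real_zeros_le hu
  refine ⟨ξ, α, α * |ξ| + β, hξ, hα, by positivity, fun r hr Z hZ => ?_⟩
  have hZ' : ∀ x ∈ Z, |x| ≤ r + |ξ| ∧ weilMellin u (1 / 2 + (x : ℂ) * I) = 0 := by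
    intro x hx
    refine ⟨?_, (hZ x hx).2⟩
    have h1 : |x| ≤ |x - ξ| + |ξ| := by
      have := abs_add_le (x - ξ) ξ
      rwa [sub_add_cancel] at this
    linarith [(hZ x hx).1]
  have h1 := h (r + |ξ|) (by positivity) Z hZ'
  linarith

/-- **Jensen zero count for ground-state transforms** (the form used by the line
`conjugate-point`): for every ground state `u` of a window `[-a, a]` there are `ξ α β` such that for
every `r ≥ 1` every finite set of (distinct) real zeros of `x ↦ û(1/2 + ix)` within `r` of `ξ` has
at most `α r + β` elements. [folklore] -/
theorem groundState_card_real_zeros_le :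
    ∀ (a : ℝ) (u : ℝ → ℂ), Literature.NumberTheory.LFunctions.IsWeilGroundState a u →
      ∃ ξ α β : ℝ, ∀ r : ℝ, 1 ≤ r → ∀ Z : Finset ℝ,
        (∀ x ∈ Z, |x - ξ| ≤ r ∧
          Literature.NumberTheory.LFunctions.weilMellin u (1 / 2 + (x : ℂ) * Complex.I) = 0) →
          (Z.card : ℝ) ≤ α * r + β := by
  intro a u hu
  obtain ⟨ξ, α, β, -, -, -, h⟩ := exists_card_real_zeros_near_le hu
  exact ⟨ξ, α, β, fun r hr Z hZ => h r (by linarith) Z hZ⟩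


/-! ## §2 The gap lemma -/

/-- **stub_gapLemma (RH-FREE).** A real family reproducing `W` on the Weil tests of `[-2a, 2a]`
whose multiplicities are bounded by `M` is NOT contained in the zero set of the transform
`û(1/2 + i·)` of any ground state `u` of the window `[-a, a]`: the lower local Weyl law
(`card_near_ge_log_of_windowTrace`) supplies `≥ N (c log N − C) / M` distinct atoms in `N` disjoint
`R₀`-windows at heights `≍ N`, more than the `O(N)` real zeros `û(1/2 + i·)` can have there by the
Jensen count `exists_card_real_zeros_le`. [folklore] -/
theorem stub_gapLemma :
    ∀ a : ℝ, 0 < a → ∀ u : ℝ → ℂ, Literature.NumberTheory.LFunctions.IsWeilGroundState a u →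
      ∀ (M : ℕ) (ι : Type) (γ : ι → ℝ), (∀ x : ℝ, {i : ι | γ i = x}.encard ≤ M) →
        (∀ g : ℝ → ℂ, Literature.NumberTheory.LFunctions.IsWeilTest g →
          tsupport g ⊆ Set.Icc (-(2 * a)) (2 * a) →
            HasSum (fun i => Literature.NumberTheory.LFunctions.weilMellin g (1 / 2 + (γ i : ℂ) * Complex.I))
              (Literature.NumberTheory.LFunctions.weilFunctional g)) →
        ∃ i : ι, Literature.NumberTheory.LFunctions.weilMellin u (1 / 2 + (γ i : ℂ) * Complex.I) ≠ 0 := by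
  intro a ha u hu M ι γ hmult hγ
  classical
  by_contra hcon
  push Not at hcon
  -- §1: the Jensen count of the real zeros of `F = û(1/2 + i·)`
  obtain ⟨α, β, hα, hβ, hJ⟩ := exists_card_real_zeros_le hu
  -- the lower local Weyl law at level `2a`
  obtain ⟨R₀, c, C, hR₀, hc, hcorr⟩ :=
    card_near_ge_log_of_windowTrace (by positivity : (0 : ℝ) < 2 * a)
  choose s hs_near hs_card using hcorr ι γ hγ
  -- spacing of the cells and the number of cells
  set L : ℝ := 2 * R₀ + 2 with hL
  have hL2 : 2 ≤ L := by rw [hL]; linarith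
  set K : ℝ := C + M * (2 * L * α + α * R₀ + β) + 1 with hK
  obtain ⟨N, hN⟩ := exists_nat_gt (Real.exp (K / c))
  have hNpos : (0 : ℝ) < N := (Real.exp_pos _).trans hN
  have hN1 : (1 : ℝ) ≤ N := by
    have h : 0 < N := by exact_mod_cast hNpos
    exact_mod_cast h
  have hlogN : K < c * Real.log N := by
    have h1 : K / c < Real.log N := by
      rw [← Real.log_exp (K / c)]
      exact Real.log_lt_log (Real.exp_pos _) hN
    rw [div_lt_iff₀ hc] at h1
    linarith
  -- the cells `T_j = L j`, `N ≤ j < 2N`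
  set J : Finset ℕ := Finset.Ico N (2 * N) with hJdef
  have hJcard : J.card = N := by
    rw [hJdef, Nat.card_Ico]
    omega
  set T : ℕ → ℝ := fun j => L * j with hT
  have hT0 : ∀ j : ℕ, 0 ≤ T j := fun j => by positivity
  -- each cell holds at least `c log N − C` indices
  have hcell : ∀ j ∈ J, c * Real.log N - C ≤ ((s (T j)).card : ℝ) := by
    intro j hj
    have hjN : (N : ℝ) ≤ j := by exact_mod_cast (Finset.mem_Ico.1 hj).1
    have hj0 : (0 : ℝ) ≤ j := Nat.cast_nonneg j
    have h1 : (N : ℝ) ≤ 1 + |T j| := by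
      rw [abs_of_nonneg (hT0 j)]
      have h2 : (j : ℝ) ≤ L * j := by nlinarith
      show (N : ℝ) ≤ 1 + L * j
      linarith
    have h2 : Real.log N ≤ Real.log (1 + |T j|) := Real.log_le_log hNpos h1
    have h3 := hs_card (T j)
    nlinarith [h2, hc.le]
  -- the cells are pairwise disjoint
  have hdisj : (J : Set ℕ).PairwiseDisjoint (fun j => s (T j)) := by
    intro j _ k _ hjk
    rw [Function.onFun, Finset.disjoint_left]
    intro i hij hik
    have h1 := hs_near (T j) i hij
    have h2 := hs_near (T k) i hik
    have h3 : |T j - T k| ≤ 2 * R₀ := by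
      calc |T j - T k| = |(γ i - T k) - (γ i - T j)| := by ring_nf
        _ ≤ |γ i - T k| + |γ i - T j| := abs_sub _ _
        _ ≤ 2 * R₀ := by linarith
    have h4 : (1 : ℝ) ≤ |(j : ℝ) - k| := by
      rcases lt_or_gt_of_ne hjk with h | h
      · have h' : (j : ℝ) + 1 ≤ k := by exact_mod_cast h
        rw [abs_sub_comm, abs_of_nonneg (by linarith)]
        linarith
      · have h' : (k : ℝ) + 1 ≤ j := by exact_mod_cast h
        rw [abs_of_nonneg (by linarith)]
        linarith
    have h5 : |T j - T k| = L * |(j : ℝ) - k| := by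
      show |L * j - L * k| = _
      rw [← mul_sub, abs_mul, abs_of_pos (by linarith)]
    have h6 : L * 1 ≤ L * |(j : ℝ) - k| := mul_le_mul_of_nonneg_left h4 (by linarith)
    linarith
  -- the union of the cells
  set U : Finset ι := J.biUnion (fun j => s (T j)) with hU
  have hUcard : (U.card : ℝ) = ∑ j ∈ J, ((s (T j)).card : ℝ) := by
    rw [hU, Finset.card_biUnion hdisj]
    push_cast
    rfl
  have hUlow : (N : ℝ) * (c * Real.log N - C) ≤ U.card := by
    rw [hUcard]
    calc (N : ℝ) * (c * Real.log N - C) = ∑ _j ∈ J, (c * Real.log N - C) := by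
          rw [Finset.sum_const, hJcard, nsmul_eq_mul]
      _ ≤ ∑ j ∈ J, ((s (T j)).card : ℝ) := Finset.sum_le_sum hcell
  -- bounded multiplicity: `#U ≤ M · #γ(U)`
  set Z : Finset ℝ := U.image γ with hZ
  have hfib : ∀ x ∈ U.image γ, (U.filter (fun i => γ i = x)).card ≤ M := by
    intro x _
    have h1 : ((U.filter (fun i => γ i = x) : Finset ι) : Set ι) ⊆ {i : ι | γ i = x} := by
      intro i hi
      simp only [Finset.coe_filter, Set.mem_setOf_eq] at hi
      exact hi.2
    have h2 := (Set.encard_le_encard h1).trans (hmult x)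
    rw [Set.encard_coe_eq_coe_finsetCard] at h2
    exact_mod_cast h2
  have hUZ : U.card ≤ M * Z.card := Finset.card_le_mul_card_image U M hfib
  -- `γ(U)` is a set of real zeros of `F` in `[-(R₀ + 2LN), R₀ + 2LN]`
  have hZzeros : ∀ x ∈ Z, |x| ≤ R₀ + 2 * L * N ∧ weilMellin u (1 / 2 + (x : ℂ) * I) = 0 := by
    intro x hx
    obtain ⟨i, hiU, rfl⟩ := Finset.mem_image.1 hx
    refine ⟨?_, hcon i⟩
    obtain ⟨j, hj, hij⟩ := Finset.mem_biUnion.1 hiU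
    have h1 := hs_near (T j) i hij
    have hj2 : (j : ℝ) ≤ 2 * N := by
      have h := (Finset.mem_Ico.1 hj).2
      exact_mod_cast h.le
    have hTj : |T j| ≤ 2 * L * N := by
      rw [abs_of_nonneg (hT0 j)]
      show L * (j : ℝ) ≤ 2 * L * N
      nlinarith
    calc |γ i| = |(γ i - T j) + T j| := by ring_nf
      _ ≤ |γ i - T j| + |T j| := abs_add_le _ _
      _ ≤ R₀ + 2 * L * N := by linarith
  have hZup : (Z.card : ℝ) ≤ α * (R₀ + 2 * L * N) + β := hJ _ (by positivity) Z hZzeros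
  -- assemble
  have hUZ' : (U.card : ℝ) ≤ M * Z.card := by exact_mod_cast hUZ
  have hM0 : (0 : ℝ) ≤ M := Nat.cast_nonneg M
  have key : (N : ℝ) * (c * Real.log N - C) ≤ M * (α * (R₀ + 2 * L * N) + β) :=
    hUlow.trans (hUZ'.trans (mul_le_mul_of_nonneg_left hZup hM0))
  have h1 : M * (2 * L * α + α * R₀ + β) + 1 ≤ c * Real.log N - C := by linarith
  have h2 : (N : ℝ) * (M * (2 * L * α + α * R₀ + β) + 1) ≤ N * (c * Real.log N - C) :=
    mul_le_mul_of_nonneg_left h1 hNpos.le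
  have h3 : (M : ℝ) * (α * R₀ + β) ≤ N * (M * (α * R₀ + β)) :=
    le_mul_of_one_le_left (by positivity) hN1
  linarith

end Summit.RiemannHypothesis.RiemannHypothesis.Theorems.SpectralTraceWindowStep

end
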